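/-
Copyright: the b2b-balaban T⁴-continuum CRUX team, row NE7b leaf lineage `t4-ne7b-formalise-leaf-01` (gen 85). Project licence.
-/
import Summits.QuantumFields.BalabanUV.T4Continuum.Spine.NE7b.TwoScalePoincareTransported
import Summits.QuantumFields.BalabanUV.T4Continuum.Spine.NE7b.CubePoincareTensorised

/-!
# THE FREE-FIELD INSTANCE WITH NO LETTER LEFT OPEN: the cube of side `L²` in dimension `d`, blocked by its `L^d` sub-cubes of side `L`,
# the Dirichlet form of the cube as a continuous bilinear form `Q` on `EuclideanSpace ℝ (Fin d → Fin (L·L))`, and the next kernel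
# coercivity of the hard-step chain BY VALUE: every coarse field `k` with zero mean has
# `((L·L)(L·L − 1))⁻¹·L^d·‖k‖² ≤ Q (S k) (S k)` — `…TransportedFormCoercivity.kerCoercive_bilinearComp_div` through
# `…TwoScalePoincareTransported`, the two-scale letter discharged by `…CubePoincareTensorised` (row NE7b, node U5c; [folklore])

Cell `pub-balaban`, sub-cell `t4`, spine estimate NE7b (`T4WeightBudget.RelWeightBound`; the cell's OWN estimate — NOT PRINTED in
[Bałaban 1983–89], NOT PROVED).  Crux-route work under `Spine/NE7b/` by a row leaf (`t4-ne7b-formalise-leaf-01` gen 85) under FREEZE (0)'s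
crux-prover clause; NOTHING of Bałaban's is named as a Lean object, valued or asserted; no `T4Continuum/Support` leaf typed; no `def` (the
operators `D`, `S`, `D⁺`, `Q` are carried by characterising hypotheses and INHABITED); zero `sorry`.  Imports: this lineage's TSPT (hence TSPB,
leaf-03's TFC, Mathlib `PiL2`) and CPT.

WHY.  TSPB valued HSTB's model letters in sum currency, CPT gave the cube's Poincaré constant `n(n − 1)` in every dimension, TSPT moved the
letters into the chain's `EuclideanSpace` ∕ CLM currency and fed TFC BY NAME — with the form `Q` and its two-scale letter still HYPOTHESES.
THIS FILE discharges them for the free field on ONE composite block: sites `Fin d → Fin (L·L)` (the cube of side `L²`), blocks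
`x ↦ (a ↦ (x a).divNat)` (its `L^d` sub-cubes of side `L`, every fibre of size EXACTLY `L^d` — `card_fibre_divNat`), one coarse block (so
`ker D⁺` = zero coarse mean and the composite-block condition is the zero TOTAL sum), and `Q` = the cube's nearest-neighbour Dirichlet form as
a CLM (`exists_dirichletCLM`: a finite sum of rank-one forms `ℓ ⊗ ℓ`, `ℓ = proj(x + e_a) − proj(x)`).  CPT's `cubePoincare` at `n = L·L`
gives the two-scale letter with `m₂ = ((L·L)(L·L − 1))⁻¹`, and TSPT's END gives the next kernel coercivity `m₂·L^d` on `ker D⁺` for the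
block-constant section `S` — BY VALUE, BY NAME, NO LETTER LEFT OPEN.  With the canonical `t² = L²∕L^d` this is TSPB's carried
`m = (L² − 1)⁻¹` again (`closing_instance`).

WHAT IS PROVED ([folklore]):
* §1 `card_fibre_divNat` (every sub-cube has `L^d` sites), `sum_filter_const_unit` (one coarse block: the composite-block sums are the total sum).
* §2 `exists_dirichletCLM` — the cube's Dirichlet form as `Q : E →L E →L ℝ` with
  `Q v w = Σ_a Σ_x [x_a + 1 < n]·(v(x + e_a) − v x)(w(x + e_a) − w x)`; `dirichlet_twoScale_letter` (zero total sum ⟹ `m₂‖v‖² ≤ Q v v`, CPT BY NAME).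
* §3 **`freeField_nextKerCoercive`** — THE INSTANCE END: `0 < L`; `D`, `S`, `D⁺`, `Q` by their characterising hypotheses ⊢
  `∀ k, D⁺ k = 0 → ((L·L)·(L·L − 1))⁻¹·L^d·‖k‖² ≤ (Q.bilinearComp S S) k k`; **`freeField_instance_exists`** (the same with the four
  operators' existence discharged: `∃ D S D⁺ Q, …`); `closing_instance` (`(L²∕L^d)·(((L·L)(L·L−1))⁻¹·L^d) = (L² − 1)⁻¹`, TSPB `closing_by_value` BY NAME).

NOT HERE (honest): the torus ∕ many composite blocks (one composite block carries the whole two-scale content; a disjoint union only repeats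
it); the sharp constant; the minimising section instead of the block-constant one (TFC works for any right inverse; the minimiser only
improves `Q(Sk)(Sk)`); the sup-norm currency; print's blocking ∕ form ((A3) ∕ (A1c), NC-NE7b-α UNRULED) — the free scalar field is the MODEL.
BY-NAME EFFECT ON THE WALL: NONE.  NE7b NOT PRINTED ∕ NOT PROVED; spine PROVED 0∕9; rung (B)+1 on a FINITE torus — NOT infinite volume, NOT the
mass gap, NOT Clay.  HONEST DEPENDENCY: continuum YM on T⁴ ⇐ BetaPertH ∧ nine spine estimates (0∕9 proved); BetaPertH ⇐ (D1) ∧ (D4) ∧ CAP+tail;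
G-an2-4 gates asym, D1 and NE2∕3∕4.
-/

set_option autoImplicit false

open Finset

namespace Summit.QuantumFields.BalabanUV.T4Continuum.NE7b.FreeFieldTwoScaleInstance

open Summit.QuantumFields.BalabanUV.T4Continuum.NE7b.TwoScalePoincareBlocking (closing_by_value)
open Summit.QuantumFields.BalabanUV.T4Continuum.NE7b.TwoScalePoincareTransported
  (norm_sq_eq_sum_sq kerCoercive_next_of_twoScalePoincare)
open Summit.QuantumFields.BalabanUV.T4Continuum.NE7b.CubePoincareTensorised (cubePoincare)

/-! ## §1. The cube of side `L·L` and its sub-cubes of side `L` -/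

/-- **EVERY SUB-CUBE HAS `L^d` SITES**: the fibre of `x ↦ (a ↦ (x a).divNat)` over `y : Fin d → Fin L` is the image of `Fin d → Fin L` under
`r ↦ (a ↦ finProdFinEquiv (y a, r a))`, which is injective. [folklore] -/
theorem card_fibre_divNat (d L : ℕ) (y : Fin d → Fin L) :
    #(univ.filter fun x : Fin d → Fin (L * L) => (fun a => (x a).divNat) = y) = L ^ d := by
  classical
  have hset : (univ.filter fun x : Fin d → Fin (L * L) => (fun a => (x a).divNat) = y) =
      univ.image (fun r : Fin d → Fin L => fun a => finProdFinEquiv (y a, r a)) := by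
    ext x
    simp only [mem_filter, mem_univ, true_and, mem_image]
    constructor
    · intro h
      refine ⟨fun a => (x a).modNat, funext fun a => ?_⟩
      have h2 := finProdFinEquiv.apply_symm_apply (x a)
      rw [finProdFinEquiv_symm_apply] at h2
      have ha : (x a).divNat = y a := congrFun h a
      rw [← ha]
      exact h2
    · rintro ⟨r, rfl⟩
      funext a
      have h2 := finProdFinEquiv.symm_apply_apply (y a, r a)
      rw [finProdFinEquiv_symm_apply, Prod.mk.injEq] at h2
      exact h2.1
  have hinj : Function.Injective (fun r : Fin d → Fin L => fun a => finProdFinEquiv (y a, r a)) := by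
    intro r r' h
    funext a
    have ha := congrFun h a
    simpa using ha
  rw [hset, card_image_of_injective _ hinj, card_univ, Fintype.card_fun, Fintype.card_fin, Fintype.card_fin]

/-- ONE COARSE BLOCK: with `blk₂ : β → Unit`, the composite-block sum over the fibre of `z : Unit` is the total sum. [folklore] -/
theorem sum_filter_const_unit {σ β : Type*} [Fintype σ] (blk : σ → β) (v : σ → ℝ) (z : Unit) :
    ∑ x ∈ univ.filter (fun x => (fun _ : β => ()) (blk x) = z), v x = ∑ x, v x := by
  congr 1
  ext x
  simp

/-! ## §2. The Dirichlet form of the cube as a continuous bilinear form -/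

/-- **THE CUBE's DIRICHLET FORM EXISTS AS A CLM** `Q : E →L E →L ℝ` on `E = EuclideanSpace ℝ (Fin d → Fin n)` with
`Q v w = Σ_{a} Σ_{x} [x_a + 1 < n]·(v(x + e_a) − v x)·(w(x + e_a) − w x)` — a finite sum of rank-one forms `ℓ ⊗ ℓ` with
`ℓ = proj(x + e_a) − proj x`. [folklore] -/
theorem exists_dirichletCLM (d n : ℕ) :
    ∃ Q : EuclideanSpace ℝ (Fin d → Fin n) →L[ℝ] EuclideanSpace ℝ (Fin d → Fin n) →L[ℝ] ℝ,
      ∀ v w : EuclideanSpace ℝ (Fin d → Fin n), Q v w = ∑ a : Fin d, ∑ x : Fin d → Fin n,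
        (if h : (x a : ℕ) + 1 < n then
          (v (Function.update x a ⟨(x a : ℕ) + 1, h⟩) - v x) * (w (Function.update x a ⟨(x a : ℕ) + 1, h⟩) - w x) else 0) := by
  classical
  refine ⟨∑ a : Fin d, ∑ x : Fin d → Fin n, (if h : (x a : ℕ) + 1 < n then
      ContinuousLinearMap.smulRight
        ((EuclideanSpace.proj (Function.update x a ⟨(x a : ℕ) + 1, h⟩) : EuclideanSpace ℝ (Fin d → Fin n) →L[ℝ] ℝ) -
          EuclideanSpace.proj x)
        ((EuclideanSpace.proj (Function.update x a ⟨(x a : ℕ) + 1, h⟩) : EuclideanSpace ℝ (Fin d → Fin n) →L[ℝ] ℝ) -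
          EuclideanSpace.proj x) else 0), fun v w => ?_⟩
  have happ : ∀ T : Fin d → (Fin d → Fin n) →
      (EuclideanSpace ℝ (Fin d → Fin n) →L[ℝ] EuclideanSpace ℝ (Fin d → Fin n) →L[ℝ] ℝ),
      (∑ a, ∑ x, T a x) v w = ∑ a, ∑ x, T a x v w := fun T => by simp
  rw [happ]
  refine sum_congr rfl fun a _ => sum_congr rfl fun x _ => ?_
  split_ifs with h
  · simp
  · simp

/-- **THE TWO-SCALE LETTER OF THE CUBE's DIRICHLET FORM, CPT BY NAME**: on the cube of side `n ≥ 1`, a field with zero total sum has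
`(n(n − 1))⁻¹·‖v‖² ≤ Q v v` for any `Q` with the Dirichlet evaluation formula. [folklore] -/
theorem dirichlet_twoScale_letter {d n : ℕ} (hn : 0 < n)
    {Q : EuclideanSpace ℝ (Fin d → Fin n) →L[ℝ] EuclideanSpace ℝ (Fin d → Fin n) →L[ℝ] ℝ}
    (hQ : ∀ v w : EuclideanSpace ℝ (Fin d → Fin n), Q v w = ∑ a : Fin d, ∑ x : Fin d → Fin n,
        (if h : (x a : ℕ) + 1 < n then
          (v (Function.update x a ⟨(x a : ℕ) + 1, h⟩) - v x) * (w (Function.update x a ⟨(x a : ℕ) + 1, h⟩) - w x) else 0))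
    (v : EuclideanSpace ℝ (Fin d → Fin n)) (h0 : ∑ x, v x = 0) :
    ((n : ℝ) * (n - 1))⁻¹ * ‖v‖ ^ 2 ≤ Q v v := by
  have hE : Q v v = ∑ a : Fin d, ∑ x : Fin d → Fin n,
      (if h : (x a : ℕ) + 1 < n then (v (Function.update x a ⟨(x a : ℕ) + 1, h⟩) - v x) ^ 2 else 0) := by
    rw [hQ]
    refine sum_congr rfl fun a _ => sum_congr rfl fun x _ => ?_
    split_ifs with h
    · ring
    · rfl
  have hP := cubePoincare hn d (fun x => v x) h0
  have hEnn : 0 ≤ Q v v := by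
    rw [hE]
    exact sum_nonneg fun a _ => sum_nonneg fun x _ => by split_ifs <;> positivity
  rw [norm_sq_eq_sum_sq, hE]
  rw [hE] at hEnn
  set c : ℝ := (n : ℝ) * (n - 1) with hc
  have hc0 : 0 ≤ c := by
    have : (1 : ℝ) ≤ n := by exact_mod_cast hn
    rw [hc]; nlinarith
  rcases hc0.eq_or_lt with hzero | hpos
  · rw [← hzero, inv_zero, zero_mul]
    exact hEnn
  · rw [inv_mul_le_iff₀ hpos]
    exact hP

/-! ## §3. THE INSTANCE END -/

/-- **THE FREE-FIELD NEXT KERNEL COERCIVITY, NO LETTER LEFT OPEN.**  Dimension `d`, `0 < L`; sites `Fin d → Fin (L·L)` (the cube of side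
`L²`), blocks by sub-cubes of side `L` (`x ↦ (a ↦ (x a).divNat)`), one coarse block; `D`, `S`, `D⁺` the block average, block-constant section
and coarse average as CLMs on `EuclideanSpace` (characterising hypotheses — inhabited by TSPT), `Q` the cube's Dirichlet form (by its
evaluation formula — inhabited by `exists_dirichletCLM`).  Then every coarse field `k` with `D⁺ k = 0` (zero coarse mean) has
`((L·L)·(L·L − 1))⁻¹·L^d·‖k‖² ≤ (Q.bilinearComp S S) k k` — TSPT `kerCoercive_next_of_twoScalePoincare` (TFC by name) with the two-scale
letter discharged by CPT `cubePoincare`. [folklore] -/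
theorem freeField_nextKerCoercive (d : ℕ) {L : ℕ} (hL : 0 < L)
    {D : EuclideanSpace ℝ (Fin d → Fin (L * L)) →L[ℝ] EuclideanSpace ℝ (Fin d → Fin L)}
    {S : EuclideanSpace ℝ (Fin d → Fin L) →L[ℝ] EuclideanSpace ℝ (Fin d → Fin (L * L))}
    {Dn : EuclideanSpace ℝ (Fin d → Fin L) →L[ℝ] EuclideanSpace ℝ Unit}
    {Q : EuclideanSpace ℝ (Fin d → Fin (L * L)) →L[ℝ] EuclideanSpace ℝ (Fin d → Fin (L * L)) →L[ℝ] ℝ}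
    (hD : ∀ (v : EuclideanSpace ℝ (Fin d → Fin (L * L))) (y : Fin d → Fin L),
      D v y = (∑ x ∈ univ.filter (fun x : Fin d → Fin (L * L) => (fun a => (x a).divNat) = y), v x) /
        #(univ.filter fun x : Fin d → Fin (L * L) => (fun a => (x a).divNat) = y))
    (hS : ∀ (k : EuclideanSpace ℝ (Fin d → Fin L)) (x : Fin d → Fin (L * L)), S k x = k (fun a => (x a).divNat))
    (hDn : ∀ (k : EuclideanSpace ℝ (Fin d → Fin L)) (z : Unit),
      Dn k z = (∑ y ∈ univ.filter (fun y : Fin d → Fin L => (fun _ : Fin d → Fin L => ()) y = z), k y) /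
        #(univ.filter fun y : Fin d → Fin L => (fun _ : Fin d → Fin L => ()) y = z))
    (hQ : ∀ v w : EuclideanSpace ℝ (Fin d → Fin (L * L)), Q v w = ∑ a : Fin d, ∑ x : Fin d → Fin (L * L),
        (if h : (x a : ℕ) + 1 < L * L then
          (v (Function.update x a ⟨(x a : ℕ) + 1, h⟩) - v x) * (w (Function.update x a ⟨(x a : ℕ) + 1, h⟩) - w x) else 0)) :
    ∀ k, Dn k = 0 → (((L : ℝ) * L) * ((L : ℝ) * L - 1))⁻¹ * (L : ℝ) ^ d * ‖k‖ ^ 2 ≤ Q.bilinearComp S S k k := by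
  have hLL : 0 < L * L := Nat.mul_pos hL hL
  have hN : 0 < L ^ d := pow_pos hL d
  have hfib : ∀ y : Fin d → Fin L, #(univ.filter fun x : Fin d → Fin (L * L) => (fun a => (x a).divNat) = y) = L ^ d :=
    card_fibre_divNat d L
  have hm₂ : 0 ≤ (((L : ℝ) * L) * ((L : ℝ) * L - 1))⁻¹ := by
    have : (1 : ℝ) ≤ (L : ℝ) * L := by exact_mod_cast hLL
    have h' : 0 ≤ ((L : ℝ) * L) * ((L : ℝ) * L - 1) := by nlinarith
    exact inv_nonneg.2 h'
  have hletter : ∀ v : EuclideanSpace ℝ (Fin d → Fin (L * L)),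
      (∀ z, ∑ x ∈ univ.filter (fun x => (fun _ : Fin d → Fin L => ()) ((fun a => (x a).divNat)) = z), v x = 0) →
        (((L : ℝ) * L) * ((L : ℝ) * L - 1))⁻¹ * ‖v‖ ^ 2 ≤ Q v v := fun v hv => by
    have h0 : ∑ x, v x = 0 := by
      rw [← sum_filter_const_unit (fun x : Fin d → Fin (L * L) => fun a => (x a).divNat) (fun x => v x) ()]
      exact hv ()
    have h := dirichlet_twoScale_letter hLL hQ v h0
    push_cast at h
    exact h
  have h := kerCoercive_next_of_twoScalePoincare (fun x : Fin d → Fin (L * L) => fun a => (x a).divNat)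
    (fun _ : Fin d → Fin L => ()) hD hS hDn hN hfib hm₂ hletter
  intro k hk
  have h' := h k hk
  push_cast at h'
  exact h'

/-- **CLOSED FORM — THE OPERATORS EXIST AND THE BOUND HOLDS**: for `0 < L` there ARE CLMs `D`, `S`, `D⁺` (block average, block-constant
section, coarse average) and a form `Q` (the cube's Dirichlet form) with their characterising properties, and for them every `k ∈ ker D⁺` obeys
`((L·L)(L·L − 1))⁻¹·L^d·‖k‖² ≤ (Q.bilinearComp S S) k k` — the instance with every existential discharged. [folklore] -/
theorem freeField_instance_exists (d : ℕ) {L : ℕ} (hL : 0 < L) :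
    ∃ (D : EuclideanSpace ℝ (Fin d → Fin (L * L)) →L[ℝ] EuclideanSpace ℝ (Fin d → Fin L))
      (S : EuclideanSpace ℝ (Fin d → Fin L) →L[ℝ] EuclideanSpace ℝ (Fin d → Fin (L * L)))
      (Dn : EuclideanSpace ℝ (Fin d → Fin L) →L[ℝ] EuclideanSpace ℝ Unit)
      (Q : EuclideanSpace ℝ (Fin d → Fin (L * L)) →L[ℝ] EuclideanSpace ℝ (Fin d → Fin (L * L)) →L[ℝ] ℝ),
      (∀ (v : EuclideanSpace ℝ (Fin d → Fin (L * L))) (y : Fin d → Fin L),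
        D v y = (∑ x ∈ univ.filter (fun x : Fin d → Fin (L * L) => (fun a => (x a).divNat) = y), v x) /
          #(univ.filter fun x : Fin d → Fin (L * L) => (fun a => (x a).divNat) = y)) ∧
      (∀ (k : EuclideanSpace ℝ (Fin d → Fin L)) (x : Fin d → Fin (L * L)), S k x = k (fun a => (x a).divNat)) ∧
      (∀ v w : EuclideanSpace ℝ (Fin d → Fin (L * L)), Q v w = ∑ a : Fin d, ∑ x : Fin d → Fin (L * L),
        (if h : (x a : ℕ) + 1 < L * L then
          (v (Function.update x a ⟨(x a : ℕ) + 1, h⟩) - v x) * (w (Function.update x a ⟨(x a : ℕ) + 1, h⟩) - w x) else 0)) ∧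
      (∀ (k : EuclideanSpace ℝ (Fin d → Fin L)), Dn k = 0 ↔ ∑ y, k y = 0) ∧
      ∀ k, Dn k = 0 → (((L : ℝ) * L) * ((L : ℝ) * L - 1))⁻¹ * (L : ℝ) ^ d * ‖k‖ ^ 2 ≤ Q.bilinearComp S S k k := by
  obtain ⟨D, hD⟩ := TwoScalePoincareTransported.exists_blockAverageCLM
    (σ := Fin d → Fin (L * L)) (β := Fin d → Fin L) (fun x => fun a => (x a).divNat)
  obtain ⟨S, hS⟩ := TwoScalePoincareTransported.exists_blockConstantCLM
    (σ := Fin d → Fin (L * L)) (β := Fin d → Fin L) (fun x => fun a => (x a).divNat)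
  obtain ⟨Dn, hDn⟩ := TwoScalePoincareTransported.exists_blockAverageCLM
    (σ := Fin d → Fin L) (β := Unit) (fun _ => ())
  obtain ⟨Q, hQ⟩ := exists_dirichletCLM d (L * L)
  refine ⟨D, S, Dn, Q, hD, hS, hQ, fun k => ?_, freeField_nextKerCoercive d hL hD hS hDn hQ⟩
  -- `D⁺ k = 0 ↔ Σ k = 0`: one coarse block of `L^d ≥ 1` sites
  have hcard : ((#(univ : Finset (Fin d → Fin L)) : ℕ) : ℝ) ≠ 0 := by
    rw [card_univ, Fintype.card_fun, Fintype.card_fin, Fintype.card_fin]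
    exact_mod_cast (pow_pos hL d).ne'
  have hval : ∀ z, Dn k z = (∑ y, k y) / #(univ : Finset (Fin d → Fin L)) := fun z => by
    simp only [hDn, Finset.filter_true]
  constructor
  · intro h
    have hz : Dn k () = 0 := by rw [h]; simp
    rw [hval, div_eq_zero_iff, or_iff_left hcard] at hz
    exact hz
  · intro h
    ext z
    rw [PiLp.zero_apply, hval, h, zero_div]

/-- **THE CARRIED COERCIVITY AGAIN**: with the canonical `t² = L²∕L^d`, `t²·(m₂·L^d) = (L² − 1)⁻¹` for `m₂ = ((L·L)(L·L − 1))⁻¹` — TSPB's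
`closing_by_value` read on the instance (`1 < L`). [folklore] -/
theorem closing_instance {L : ℝ} (hL : 1 < L) (d : ℕ) :
    L ^ 2 / L ^ d * (((L * L) * (L * L - 1))⁻¹ * L ^ d) = (L ^ 2 - 1)⁻¹ := by
  have h := closing_by_value hL d
  have hL0 : 0 < L := lt_trans zero_lt_one hL
  have hLd : L ^ d ≠ 0 := pow_ne_zero d hL0.ne'
  rw [← h, sq, div_eq_mul_inv _ (L ^ d)⁻¹, inv_inv]
  ring

end Summit.QuantumFields.BalabanUV.T4Continuum.NE7b.FreeFieldTwoScaleInstance
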